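import Summits.QuantumFields.BalabanUV.Beta.FP.RelInvPeriodisedSliced
import Summits.QuantumFields.BalabanUV.Beta.FP.TorusCombSlots

/-!
# `BalabanUV.Beta.FP.RelInvPeriodisedCombRows` — road «FP» (binder row D1), route T: **(T-INV) AT THE COMB CHART OF RECORD** — the instance of
# `RelInvPeriodisedSliced.torus_isUnit_det_kkt_of_slots` at leaf-06's comb-coordinate slice rows `TorusCombRows.combRowsT`

HONEST DEPENDENCY (page 1, mandatory): continuum YM on T⁴ ⇐ BetaPertH ∧ nine spine estimates (0/9 proved); BetaPertH ⇐ (D1) ∧ (D4) ∧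
CAP+tail; G-an2-4 gates asym, D1 and NE2/3/4.  HONEST FRAMING (cell contract, verbatim): «discharging `BetaPertH` makes Bałaban's UV
stability UNCONDITIONAL — a real constructive-QFT result; it is NOT the continuum limit and NOT the Clay problem.»  THIS MODULE is [folklore]
bookkeeping BY NAME over leaf-05's `RelInvPeriodisedSliced.torus_isUnit_det_kkt_of_slots` and leaf-06's `TorusCombRows` ∕ `TorusCombSlots`
(`combBondT_eq`, `combBondT_injective`, `combSlotOf`, `childOf`, `combSlotOf_childOf`, `baseOf_mem_pbox`) with an2's `axEc_inl_inl` ∕ `axEc_inr_inr`.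
It mints no `Prop`, has no `def`, cites nothing, 0 sorry.
ABSOLUTE RULE (cell charter, verbatim): «No internally-minted statement may enter as a cited fact. Every hypothesis is either kernel-proved in this
package or a verbatim quotation of a PUBLISHED theorem with page reference. The manuscript(s) under audit are NOT citable for their own disputed
steps — they are the thing under adjudication; programme-internal (2001/route/tribunal) claims are never citable.»

CONTENT.  On every torus box `M` with `Lc ∣ M_i`, for every in-block root `r ∈ box (d+1) Lc` and EVERY step `j`: present the fine bonds by the FIELD
slots `(s, inl α)` (`s ∈ pbox M`, `α : Fin (d+1)`), the coarse multipliers by the MULTIPLIER slots `(s, inr m)` at the coarse sites `Torus.proj Lc s̃ = 0`,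
and slice by leaf-06's comb-coordinate rows `combRowsT (toSite r) Lc M` read on the field slots.  Then the road's sliced KKT
`kkt H₀ [Q₁₀; τ₁]` — `H₀` = the field block of `perF M (bhKStepAt d (toSite r) Lc j)`, `Q₁₀` = its coarse multiplier rows, `τ₁` = the comb rows — has a
unit determinant: **`torus_isUnit_det_kkt_combRows`**.  This is binder `h1` of `NestedStepLawOneShotJets.secondVar_oneShot_nestedStepLaw_jets(_of_uni)`
at the comb chart of record (`TID-LETTER-SPEC.md` v1 § B (iv), first system), up to the consumer's recombination of rows (`det_kkt_fromRows_mul_mul`).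
Discharges NO binder of row D1 by itself; NOT (T-ID), NOT SDF, NOT D1, NOT BetaPertH, NOT continuum, NOT Clay.  Unit `b2b-balaban-beta-d1-formalise-leaf-05`
(gen 24), 2026-08-21.
-/

noncomputable section

open scoped BigOperators Matrix

namespace Summit.QuantumFields.BalabanUV.Beta.FP.RelInvPeriodisedCombRows

open Matrix
open Literature.Probability.LatticeModels (Torus.proj)
open Literature.MathematicalPhysics.QuantumFieldTheory.Balaban1983to89
open Literature.MathematicalPhysics.QuantumFieldTheory.Balaban1983to89.Beta
open Literature.MathematicalPhysics.QuantumFieldTheory.Balaban1983to89.Beta.Composition (kkt)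
open B6Lemma24Torus (pbox)
open AffineAveraging (Site box toSite)
open OneStepResolventKernel (Fib)
open Summit.QuantumFields.BalabanUV.Beta.AxialDressingRooted (axEc axEc_inl_inl axEc_inr_inr IsCombBondAt)
open Summit.QuantumFields.BalabanUV.Beta.BorderedHessian (bhKStepAt)
open Summit.QuantumFields.BalabanUV.Beta.FP.KernelPeriodisationFib (Idx perF)
open Summit.QuantumFields.BalabanUV.Beta.FP.TorusCombForest (baseOf axisOf)
open Summit.QuantumFields.BalabanUV.Beta.FP.TorusCombRows (Res combBondT combRowsT combBondT_eq baseOf_mem_pbox)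
open Summit.QuantumFields.BalabanUV.Beta.FP.TorusCombSlots (CombSlot combSlotOf childOf combSlotOf_childOf combSlotOf_val combBondT_injective)
open Summit.QuantumFields.BalabanUV.Beta.FP.RelInvPeriodisedSliced (torus_isUnit_det_kkt_of_slots)

variable {d : ℕ} {Lc : ℕ} [NeZero Lc] {r : Fin (d + 1) → ℕ} (M : Fin (d + 1) → ℕ) [∀ μ, NeZero (M μ)]

set_option synthInstance.maxSize 1024 in
/-- **[folklore] (T-INV) ON THE TORUS AT THE COMB CHART OF RECORD — binder `h1` at leaf-06's `combRowsT`, ANY coarse presentation.**  Fine bonds = the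
field slots `(s, inl α)` of the box; coarse multipliers presented by any injective `fμ` onto the multiplier slots `(s, inr m)` at the coarse sites
`Torus.proj Lc s̃ = 0` (`hcoarse`; e.g. gan24-leaf-05's `coarseSlot` on the coarse box, or the coarse-site subtype below); `τ₁ := combRowsT (toSite r) Lc M`
read on the field slots.  For every `d`, in-block root `r`, `Lc ≥ 1`, EVERY step `j` and every box `M` with `Lc ∣ M_i` the sliced KKT has a unit determinant. -/
theorem torus_isUnit_det_kkt_combRows (hr : r ∈ box (d + 1) Lc) (hM : ∀ i, Lc ∣ M i) (j : ℕ)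
    {μ : Type*} [Fintype μ] [DecidableEq μ] (fμ : μ → Idx M (Fib d)) (hfμ : Function.Injective fμ)
    (hμ : ∀ a : μ, ∃ m : Fin (d + 1), (fμ a).2 = Sum.inr m)
    (hcoarse : ∀ (s : ↥(pbox M)) (m : Fin (d + 1)), ((s, Sum.inr m) : Idx M (Fib d)) ∈ Set.range fμ ↔ Torus.proj Lc (s : Site (d + 1)) = 0) :
    IsUnit (kkt
      ((perF M (bhKStepAt d (toSite r) Lc j)).submatrix (fun b : ↥(pbox M) × Fin (d + 1) => ((b.1, Sum.inl b.2) : Idx M (Fib d)))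
        (fun b : ↥(pbox M) × Fin (d + 1) => ((b.1, Sum.inl b.2) : Idx M (Fib d))))
      (fromRows
        ((perF M (bhKStepAt d (toSite r) Lc j)).submatrix fμ (fun b : ↥(pbox M) × Fin (d + 1) => ((b.1, Sum.inl b.2) : Idx M (Fib d))))
        ((combRowsT (toSite r) Lc M).submatrix id (fun b : ↥(pbox M) × Fin (d + 1) => ((b.1, Sum.inl b.2) : Idx M (Fib d)))))).det := by
  have hLc : 0 < Lc := Nat.pos_of_ne_zero (NeZero.ne Lc)
  have hρ : ∀ i, 0 ≤ toSite r i ∧ toSite r i < (Lc : ℤ) := fun i => by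
    have h := (Fintype.mem_piFinset.mp hr) i
    rw [Finset.mem_range] at h
    exact ⟨by simp only [toSite]; positivity, by simp only [toSite]; exact_mod_cast h⟩
  set fν : ↥(pbox M) × Fin (d + 1) → Idx M (Fib d) := fun b => (b.1, Sum.inl b.2) with hfν
  -- the comb map read in the field-slot index: `fν (cb x) = combBondT x`
  let cb : Res (toSite r) Lc M → ↥(pbox M) × Fin (d + 1) := fun x =>
    (⟨baseOf (toSite r) Lc x.site, baseOf_mem_pbox hLc hρ hM x⟩, axisOf (toSite r) Lc x.site)
  have hcbf : ∀ x, fν (cb x) = combBondT (toSite r) Lc M x := fun x => by rw [combBondT_eq hLc hρ hM x]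
  have hfν_inj : Function.Injective fν := by
    rintro ⟨s, α⟩ ⟨s', α'⟩ h
    simp only [hfν, Prod.mk.injEq, Sum.inl.injEq] at h
    exact Prod.ext h.1 h.2
  have hcb : Function.Injective cb := fun x y h =>
    combBondT_injective hLc hρ hM (by rw [← hcbf, ← hcbf, h])
  -- the comb rows read on the field slots ARE the coordinate rows of `cb`
  have hτ : (combRowsT (toSite r) Lc M).submatrix id fν = Matrix.of fun x b => if b = cb x then (1 : ℝ) else 0 := by
    ext x b
    rw [submatrix_apply, of_apply, id, combRowsT, ← hcbf]
    by_cases h : b = cb x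
    · rw [if_pos (congrArg fν h), if_pos h]
    · rw [if_neg (fun e => h (hfν_inj e)), if_neg h]
  rw [hτ]
  refine torus_isUnit_det_kkt_of_slots M hr hM j fν fμ hfν_inj hfμ (fun b => ⟨b.2, rfl⟩) hμ cb hcb ?_
  -- the live reading: non-comb field slots ⊕ coarse multiplier slots
  rintro ⟨s, α | m⟩
  · rw [axEc_inl_inl]
    constructor
    · intro h
      have hnc : ¬ IsCombBondAt (toSite r) Lc α (s : Site (d + 1)) := fun hc => by
        rw [if_neg (fun h3 => h3.2.2 hc)] at h; exact zero_ne_one h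
      refine Or.inl ⟨(s, α), ?_, rfl⟩
      rintro ⟨x, hx⟩
      have hslot := (combSlotOf (toSite r) Lc M hLc hρ hM x).2
      rw [combSlotOf_val, ← hcbf, hx] at hslot
      obtain ⟨m', hm', hc'⟩ := hslot
      have e : α = m' := Sum.inl_injective hm'
      subst e
      exact hnc hc'
    · rintro (⟨b, hb, hbp⟩ | ⟨a, ha⟩)
      · have hbs : b = (s, α) := hfν_inj hbp
        subst hbs
        have hnc : ¬ IsCombBondAt (toSite r) Lc α (s : Site (d + 1)) := fun hc => by
          apply hb
          let q : CombSlot (toSite r) Lc M := ⟨(s, Sum.inl α), α, rfl, hc⟩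
          refine ⟨childOf (toSite r) Lc M hLc hM q, hfν_inj ?_⟩
          rw [hcbf, ← combSlotOf_val hLc hρ hM, combSlotOf_childOf hLc hρ hM q]
        rw [if_pos ⟨rfl, rfl, hnc⟩]
      · obtain ⟨m, hm⟩ := hμ a
        rw [ha] at hm
        exact absurd hm Sum.inl_ne_inr
  · rw [axEc_inr_inr]
    constructor
    · intro h
      have hps : Torus.proj Lc (s : Site (d + 1)) = 0 := by
        by_contra hc
        rw [if_neg (fun h3 => hc h3.2.2)] at h; exact zero_ne_one h
      exact Or.inr ((hcoarse s m).2 hps)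
    · rintro (⟨b, -, hbp⟩ | ha)
      · exact absurd (congrArg Prod.snd hbp) Sum.inl_ne_inr
      · rw [if_pos ⟨rfl, rfl, (hcoarse s m).1 ha⟩]

set_option synthInstance.maxSize 1024 in
/-- [folklore] The same with the coarse multipliers presented by the COARSE-SITE subtype of the box: `(s, m) ↦ (s, inr m)`, `Torus.proj Lc s̃ = 0`. -/
theorem torus_isUnit_det_kkt_combRows_coarseSites (hr : r ∈ box (d + 1) Lc) (hM : ∀ i, Lc ∣ M i) (j : ℕ) :
    IsUnit (kkt
      ((perF M (bhKStepAt d (toSite r) Lc j)).submatrix (fun b : ↥(pbox M) × Fin (d + 1) => ((b.1, Sum.inl b.2) : Idx M (Fib d)))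
        (fun b : ↥(pbox M) × Fin (d + 1) => ((b.1, Sum.inl b.2) : Idx M (Fib d))))
      (fromRows
        ((perF M (bhKStepAt d (toSite r) Lc j)).submatrix
          (fun a : {s : ↥(pbox M) // Torus.proj Lc (s : Site (d + 1)) = 0} × Fin (d + 1) => ((a.1.1, Sum.inr a.2) : Idx M (Fib d)))
          (fun b : ↥(pbox M) × Fin (d + 1) => ((b.1, Sum.inl b.2) : Idx M (Fib d))))
        ((combRowsT (toSite r) Lc M).submatrix id (fun b : ↥(pbox M) × Fin (d + 1) => ((b.1, Sum.inl b.2) : Idx M (Fib d)))))).det := by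
  refine torus_isUnit_det_kkt_combRows M hr hM j _ ?_ (fun a => ⟨a.2, rfl⟩) fun s m => ⟨?_, fun hs => ⟨(⟨s, hs⟩, m), rfl⟩⟩
  · rintro ⟨s, m⟩ ⟨s', m'⟩ h
    simp only [Prod.mk.injEq, Sum.inr.injEq] at h
    exact Prod.ext (Subtype.ext h.1) h.2
  · rintro ⟨⟨s', m'⟩, h⟩
    have h1 : (s'.1 : ↥(pbox M)) = s := congrArg Prod.fst h
    exact h1 ▸ s'.2

end Summit.QuantumFields.BalabanUV.Beta.FP.RelInvPeriodisedCombRows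

end
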